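import Summits.ResolutionOfSingularities.ResolutionOfSingularities.Theorems.HilbertSamuelEliminationSigmaMaxModificationsCorridor3IsolatedCentre
import HarnessLib

/-!
# [OURS · L1 W4.2] UNIT STARTS: isolation in the stratum survives WAITING steps, so the first GENUINE step after an isolated stage
# blows up the POINT (crux `SigmaMaxModifications` stmt-ResolutionOfSingularities-18506; conjunct `SigmaMaxModificationsCorridor3`
# stmt-…-19249; line `w_ladder` v6; plan-1 RULINGS v3.10-1 (A) «U-seg», item (3) of res-L1-w42-stub-1's DESIGN 07:1xZ)

Stub worker res-L1-w42-stub-1 (gen 3). Helper file `--supports stmt-ResolutionOfSingularities-19249 --as helper`; kernel only, no named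
fact, no new definition. The units-half extraction cuts a moving chain at stages ISOLATED in the Hilbert–Samuel locus (`Moving.Iso`); the
unit's first blow-up (CJS Def. 6.38 (ii): `X_1 = Bℓ_x(X)`) is the first GENUINE step after that stage, which may come after finitely many
WAITING steps. `Moving.Iso` itself need not survive a waiting step (the set of maximal values `Σ^max` may change), but the weaker
«`x_n` is ISOLATED IN ITS `ν`-STRATUM» does, and it is all the point-centre argument uses:

* `CanonicalNearStep.stratumIsolated_of_not_isBlownUp` — along a WAITING step (blow-up off the marked point: an isomorphism over the
  complement of the centre, GW Prop. 13.91 (3)) an open `U ∋ x_n` with `U ∩ X_n(ν) ⊆ {x_n}` pulls back to such an open at `x_{n+1}`.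
* `stratumIsolated_of_chain_of_forall_not_isBlownUp` — hence along any run of waiting steps of a chain;
  `stratumIsolated_of_iso` — at a stage where `ν` is maximal (every good stage), `Moving.Iso N s` gives such a `U`.
* `IsMaximalOrigin.stalkIdeal_centre_eq_maximalIdeal_of_stratumIsolated` — at a stage reached from a maximal origin (`ν ≠ Φ^{(N)}`),
  stratum-isolation at `x_n` forces every canonical centre through `x_n` to be the point locally: `C_{x_n} = 𝔪_{x_n}` (the centre is
  permissible — prime stalk — and lies in `X_n(ν)`; pure lemma `stalkIdeal_eq_maximalIdeal_of_support_inter_subset_singleton`).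
* `IsMaximalOrigin.stalkIdeal_centre_eq_maximalIdeal_of_iso_of_waiting` — **from an `Iso` stage `s₀` reached from a maximal origin, along
  any number of WAITING steps to `s`, the centre of a canonical step through `x_s` is the point** (hC0 of `isFundamentalUnit_localize`).

OURS bookkeeping; NOT a statement of the manuscript [Hironaka2017] nor of [CossartJannsenSaito2020]. AI-written; AI review is weaker than
expert review.

References: V. Cossart, U. Jannsen, S. Saito, LNM 2270 (2020), Def. 6.38 (ii), Def. 13.3, Rem. 6.29 (1) [CossartJannsenSaito2020];
U. Görtz, T. Wedhorn, *Algebraic Geometry I* (2nd ed.), Prop. 13.91 (3) [GortzWedhorn2020].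
-/

noncomputable section

set_option linter.dupNamespace false -- mandated namespace of this single-conjunct summit

open CategoryTheory AlgebraicGeometry TopologicalSpace Topology IsLocalRing

namespace Summit.ResolutionOfSingularities.ResolutionOfSingularities.Theorems

namespace CampaignW42

open Literature.AlgebraicGeometry.Resolution Literature.RingTheory.HilbertSamuel
open Literature.AlgebraicGeometry.CossartJannsenSaito2020
open Summit.ResolutionOfSingularities.ResolutionOfSingularities.Theorems.SigmaMaxModificationsCorridor3

universe u

variable {p : ℕ} {R : ∀ S : Scheme.{u}, CentreSeq S → Prop} {N : ℕ} {ν : ℕ → ℕ}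

/-! ## §1. Isolation in the stratum survives waiting steps -/

/-- **ISOLATION IN THE `ν`-STRATUM SURVIVES A WAITING STEP.** If the marked point of `s` is NOT blown up and some open `U ∋ x_n` meets
`X_n(ν)` only in `x_n`, then along any canonical near step `s → s'` some open `U' ∋ x_{n+1}` meets `X_{n+1}(ν)` only in `x_{n+1}`
(the blow-up is an isomorphism over the complement of its centre, which is an open neighbourhood of `x_n`; `H^N` is preserved there).
[cite: GortzWedhorn2020, Prop. 13.91 (3)] [cite: CossartJannsenSaito2020, Rem. 6.29 (1)] -/
theorem CanonicalNearStep.stratumIsolated_of_not_isBlownUp {s s' : MarkedStage.{u}} (h : CanonicalNearStep R N ν s s')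
    (hnb : ¬ s.IsBlownUp R N ν) (hU : ∃ U : Set s.W, IsOpen U ∧ s.pt ∈ U ∧ U ∩ Scheme.hsStratum s.W N ν ⊆ {s.pt}) :
    ∃ U' : Set s'.W, IsOpen U' ∧ s'.pt ∈ U' ∧ U' ∩ Scheme.hsStratum s'.W N ν ⊆ {s'.pt} := by
  obtain ⟨U, hUo, hptU, hUiso⟩ := hU
  obtain ⟨C, P', hln, x', hst, hπ, -, -, rfl⟩ := h
  haveI : IsLocallyNoetherian s.W := s.ln
  haveI : IsLocallyNoetherian (blowup C) := hln
  have hnot : s.pt ∉ (C.support : Set s.W) := fun hmem => hnb ⟨C, P', hst, hmem⟩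
  -- the open `V = U ∖ V(C)` downstairs and its preimage upstairs
  let V : s.W.Opens := ⟨(C.support : Set s.W)ᶜ, C.support.isClosed.isOpen_compl⟩
  haveI hiso : IsIso (blowup.π C ∣_ V) := (blowup.isBlowup C).isIso_compl
  refine ⟨(blowup.π C).base ⁻¹' (U ∩ (C.support : Set s.W)ᶜ), (hUo.inter C.support.isClosed.isOpen_compl).preimage
    (blowup.π C).base.hom.continuous, ?_, ?_⟩
  · show (blowup.π C).base x' ∈ U ∩ (C.support : Set s.W)ᶜ
    rw [hπ]; exact ⟨hptU, hnot⟩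
  · rintro z ⟨⟨hzU, hzC⟩, hzν⟩
    -- `H^N` is preserved off the centre, so `π z ∈ U ∩ X_n(ν) = {x_n}`
    have hHz : Scheme.hsFun (blowup C) N z = Scheme.hsFun s.W N ((blowup.π C).base z) :=
      hsFun_blowup_eq_of_notMem_support C N z hzC
    have hπz : (blowup.π C).base z = s.pt := by
      have : (blowup.π C).base z ∈ U ∩ Scheme.hsStratum s.W N ν :=
        ⟨hzU, Scheme.mem_hsStratum_iff.mpr (hHz ▸ Scheme.mem_hsStratum_iff.mp hzν)⟩
      exact hUiso this
    -- `π` is injective over `V`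
    have hinj : Function.Injective (blowup.π C ∣_ V).base := (TopCat.homeoOfIso (asIso (blowup.π C ∣_ V).base)).injective
    have hzV : z ∈ (blowup.π C) ⁻¹ᵁ V := hzC
    have hx'V : x' ∈ (blowup.π C) ⁻¹ᵁ V := by show (blowup.π C).base x' ∈ (C.support : Set s.W)ᶜ; rw [hπ]; exact hnot
    have heq : (⟨z, hzV⟩ : ↥((blowup.π C) ⁻¹ᵁ V)) = ⟨x', hx'V⟩ := by
      apply hinj
      apply Subtype.ext
      rw [morphismRestrict_base_coe, morphismRestrict_base_coe]
      show (blowup.π C).base z = (blowup.π C).base x'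
      rw [hπz, hπ]
    exact congrArg Subtype.val heq

/-- Isolation in the stratum survives along a chain segment `x_n, …, x_m` none of whose stages `x_n, …, x_{m-1}` is blown up
(WAITING steps only). [folklore] -/
theorem stratumIsolated_of_chain_of_forall_not_isBlownUp {c : ℕ → MarkedStage.{u}}
    (hc : ∀ n, CanonicalNearStep R N ν (c n) (c (n + 1))) {n m : ℕ} (hnm : n ≤ m)
    (hwait : ∀ j, n ≤ j → j < m → ¬ (c j).IsBlownUp R N ν)
    (hU : ∃ U : Set (c n).W, IsOpen U ∧ (c n).pt ∈ U ∧ U ∩ Scheme.hsStratum (c n).W N ν ⊆ {(c n).pt}) :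
    ∃ U : Set (c m).W, IsOpen U ∧ (c m).pt ∈ U ∧ U ∩ Scheme.hsStratum (c m).W N ν ⊆ {(c m).pt} := by
  induction m, hnm using Nat.le_induction with
  | base => exact hU
  | succ m hnm ih =>
    exact (hc m).stratumIsolated_of_not_isBlownUp (hwait m hnm m.lt_succ_self)
      (ih fun j hnj hjm => hwait j hnj (Nat.lt_succ_of_lt hjm))

/-! ## §2. `Moving.Iso` ⇒ isolation in the stratum; point centres -/

/-- At a stage where `ν` is never exceeded (every good stage: `StateGood.supMax`), isolation in the Hilbert–Samuel locus (`Moving.Iso`,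
CJS Def. 13.3) gives isolation in the `ν`-stratum. [cite: CossartJannsenSaito2020, Def. 13.3, Def. 2.35] -/
theorem stratumIsolated_of_iso {k : Type u} [Field k] {s : MarkedStage.{u}} (hg : StateGood k R N ν s.W s.L s.P)
    (hiso : Moving.Iso N s) :
    ∃ U : Set s.W, IsOpen U ∧ s.pt ∈ U ∧ U ∩ Scheme.hsStratum s.W N ν ⊆ {s.pt} := by
  obtain ⟨U, hU, hUmax⟩ := hiso
  have hptU : s.pt ∈ U := by
    have : s.pt ∈ U ∩ Scheme.hsMaxLocus s.W N := by rw [hUmax]; exact Set.mem_singleton _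
    exact this.1
  refine ⟨U, hU, hptU, ?_⟩
  rintro w ⟨hwU, hwν⟩
  have : w ∈ U ∩ Scheme.hsMaxLocus s.W N := ⟨hwU, hg.hsStratum_subset_hsMaxLocus hwν⟩
  rwa [hUmax] at this

/-- **STRATUM-ISOLATION FORCES POINT CENTRES.** At a stage `s` reached from a maximal origin (admissible oracle, `ν ≠ Φ^{(N)}`) whose
marked point is isolated in its `ν`-stratum, every canonical centre through the marked point has stalk `𝔪_{x_n}` there (permissible ⇒
prime stalk; centre `⊆ X_n(ν)`). [cite: CossartJannsenSaito2020, Def. 6.38 (ii), Rem. 6.29 (1)] -/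
theorem IsMaximalOrigin.stalkIdeal_centre_eq_maximalIdeal_of_stratumIsolated (hRa : OracleAdmissible R) (hν : ν ≠ iterPSum N Phi)
    {X : Scheme.{u}} [IsLocallyNoetherian X] {x : X} (hX : IsMaximalOrigin p N ν X x) {s : MarkedStage.{u}}
    (hs : Reaches R N ν (MarkedStage.init X x) s)
    (hU : ∃ U : Set s.W, IsOpen U ∧ s.pt ∈ U ∧ U ∩ Scheme.hsStratum s.W N ν ⊆ {s.pt}) {C : s.W.IdealSheafData}
    {P' : Option (Pending (blowup C))} (hst : IsCanonicalStep R N ν s.L s.P C P') (hmem : s.pt ∈ (C.support : Set s.W)) :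
    stalkIdeal C s.pt = maximalIdeal (s.W.presheaf.stalk s.pt) := by
  haveI : IsLocallyNoetherian s.W := s.ln
  obtain ⟨-, hsub, hperm, -⟩ := hX.centre_package hRa hν hs hst
  obtain ⟨U, hUo, hptU, hUiso⟩ := hU
  exact stalkIdeal_eq_maximalIdeal_of_support_inter_subset_singleton C (isPrime_stalkIdeal_of_isPermissibleAt (hperm s.pt hmem))
    hUo hptU fun w ⟨hwC, hwU⟩ => hUiso ⟨hwU, hsub hwC⟩

/-- **UNIT STARTS.** Along a canonical near chain `c` from a maximal origin (admissible oracle, `ν ≠ Φ^{(N)}`): if the stage `c n` is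
ISOLATED in the Hilbert–Samuel locus (`Moving.Iso N (c n)`) and the stages `c n, …, c (m-1)` are WAITING steps (not blown up), then every
canonical centre through the marked point of `c m` has stalk `𝔪` there — the first genuine step after an isolated stage is, locally at the
marked point, the blow-up of the point (CJS Def. 6.38 (ii), `X_1 = Bℓ_x(X)`). [cite: CossartJannsenSaito2020, Def. 6.38 (ii), Def. 13.3] -/
theorem IsMaximalOrigin.stalkIdeal_centre_eq_maximalIdeal_of_iso_of_waiting (hRa : OracleAdmissible R) (hν : ν ≠ iterPSum N Phi)
    {X : Scheme.{u}} [IsLocallyNoetherian X] {x : X} (hX : IsMaximalOrigin p N ν X x) {c : ℕ → MarkedStage.{u}}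
    (h₀ : Reaches R N ν (MarkedStage.init X x) (c 0)) (hc : ∀ n, CanonicalNearStep R N ν (c n) (c (n + 1))) {n m : ℕ}
    (hnm : n ≤ m) (hiso : Moving.Iso N (c n)) (hwait : ∀ j, n ≤ j → j < m → ¬ (c j).IsBlownUp R N ν)
    {C : (c m).W.IdealSheafData} {P' : Option (Pending (blowup C))} (hst : IsCanonicalStep R N ν (c m).L (c m).P C P')
    (hmem : (c m).pt ∈ (C.support : Set (c m).W)) : stalkIdeal C (c m).pt = maximalIdeal ((c m).W.presheaf.stalk (c m).pt) := by
  have hreach : ∀ j, Reaches R N ν (MarkedStage.init X x) (c j) := fun j => by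
    induction j with
    | zero => exact h₀
    | succ j ih => exact ih.tail (hc j)
  obtain ⟨k, _, _, hg⟩ := hX.exists_stateGood_of_reaches hRa hν (hreach n)
  exact hX.stalkIdeal_centre_eq_maximalIdeal_of_stratumIsolated hRa hν (hreach m)
    (stratumIsolated_of_chain_of_forall_not_isBlownUp hc hnm hwait (stratumIsolated_of_iso hg hiso)) hst hmem

end CampaignW42

end Summit.ResolutionOfSingularities.ResolutionOfSingularities.Theorems

end
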